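import Mathlib
import Literature.NumberTheory.EllipticCurves.IwasawaDivisibilityTransfer
import Literature.NumberTheory.EllipticCurves.IwasawaAlgebraCharIdealProofs
import Literature.NumberTheory.IwasawaTheory.IwasawaAlgebraTwoVarRegularProofs
import Summits.BirchSwinnertonDyer.BirchSwinnertonDyer.Theorems.SignedLowerHalvesKobayashiLowerHalfSemistableDefectPrime
import HarnessLib

/-!
# «TWO-VAR-PRIMES» — the height-one primes of `Λ_L = ℤ_p⟦T_+⟧⟦T_−⟧` named by the cell's G10 / S5 records
# are PRIME ELEMENTS of the two-variable ring, and the S5 `μ`-descent lemma is instance-free on the real `Λ_L`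

Kernel companions (theorems only; Mathlib + tree) for two records of the cell bsd-ssimc's verification of
Burungale–Skinner–Tian–Wan, arXiv:2409.01350 (PRE), Thm. 1.3 on corner X6 — crux 2 `KobayashiLowerHalfSemistable`
of route SignedLowerHalves (stmt-BirchSwinnertonDyer-19000), S-scoped tier behind the OPEN binder
`Supersingular.BurungaleSkinnerTianWan2024_thm13_scopedS_OPEN` (p441716). Seat bsd-ssimc-k3-c2 g19; planner D32-14
(WANTED, conditions (1)–(4)); `--supports stmt-BirchSwinnertonDyer-19000 --as helper`.

MODEL (as in p522499 and the tree's `IwasawaAlgebra₂`): `Λ_L = Λ₂ = PowerSeries (IwasawaAlgebra p)` = `ℤ_p⟦T_+⟧⟦T_−⟧`,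
OUTER variable `T_−` (`PowerSeries.X`), INNER ring `Λ^cyc = ℤ_p⟦T_+⟧` embedded by `PowerSeries.C`; the OTHER one-variable
subalgebra (outer-variable series with `ℤ_p` coefficients = the «cyclotomic elements» of
`IwasawaTransfer.dvd_of_mul_eq_mul_of_constantCoeff`'s dictionary `A = Λ^{ac}`, `X = γ_cyc − 1`) is the image of
`PowerSeries.map PowerSeries.C : ℤ_p⟦X⟧ → Λ₂`.

CONSUMERS (planner D32-14 (1)) — each declaration below is eaten by a NAMED tree statement:
* §2 `prime_coe_cyclotomic_comp₂` («`π_i = Φ_{p^(i+1)}(1+T_−)` is PRIME in the TWO-variable `Λ_L`») ⟶ the G10 =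
  I3-(R-s) record bstw-MEMO-17 (ed9c91c4af26128b) §2 (S3) «`P_i = (π_i)` is a height-one prime of `Λ_L` which SURVIVES in
  `R₁ = Λ_L ⊗_{Λ^cyc} Frac Λ^cyc`», hand-checked REPORT-bstw-15 (b); its kernel twin p522499
  `Theorems/…DefectPrime.lean` proved the element form (`DefectPrime.not_isUnit_algebraMap_localization`,
  `DefectPrime.prime_coe_cyclotomic_comp` = primality in the ONE-variable `Λ^{ac}` only) and carries the explicit
  NOT-clause «not primality of `(π_i)` in the two-variable `Λ_L`» — CLOSED here. With `prime_coe_cyclotomic_comp₂` the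
  record's «height-one prime `P_i`» is the principal prime `(π_i)` of the UFD `Λ_L`, and `not_associated_…_C` / `…_X`
  say it is none of `(p)`, `(T_+)`, `(Φ_{p^j}(1+T_+))`, `(T_−)`. It discharges NO hypothesis of any `_OPEN`-tier lemma:
  on the S-scoped tier G10 is DISCHARGED-BY-L-CHOICE (`s(L,p) = 0` ⇒ no `P_i`, MEMO-17); the `P_i` load only `s ≥ 1`.
* §2 `prime_map_C₂` («every prime of the cyclotomic algebra `ℤ_p⟦X⟧` stays prime in `Λ_L`») and §3
  `not_map_C_dvd_of_constantCoeff` ⟶ the S5 record = BSTW II §10.2.2 (proof of Thm. 10.5 = `KoMC'_lb`, last paragraph)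
  «Hence `𝓛^∘_p(g/L)` is coprime to height one prime ideals of `Λ^cyc_L`», typed by the bstw seat as
  `Literature.NumberTheory.EllipticCurves.IwasawaTransfer.isRelPrime_of_constantCoeff` (relative-primality form): §3 gives
  the PRINTED form (no height-one prime of `Λ^cyc` — i.e. no `map C q`, `q` prime in `ℤ_p⟦X⟧` — divides `L`).
* §3 `dvd_of_mul_eq_mul_of_constantCoeff₂` ⟶ `IwasawaTransfer.dvd_of_mul_eq_mul_of_constantCoeff` (S5 «the divisibility
  (tpm-div) holds in `Λ_L`»), whose explicit instance argument `[DecompositionMonoid A⟦X⟧]` («true for `ℤ_p⟦T₁,T₂⟧` …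
  but not an instance Mathlib synthesises», its docstring) is DISCHARGED on `A = ℤ_p⟦T⟧` by the typing layer's
  `Literature.NumberTheory.IwasawaTheory.uniqueFactorizationMonoid_iwasawaAlgebraTwoVar` (Auslander–Buchsbaum, landed
  2026-08-27), and whose hypothesis `hcoef` is DISCHARGED for a genuinely cyclotomic `c = map C c₀` (`hcoef_map_C`). No
  Summits-side, print-x6 or bstw24 file consumes the S5 lemma BY NAME today (tree search 2026-08-27): §3 is the
  instance-free specialisation such a consumer would cite.
* §1 is consumed by §2 (`irreducible_map_C_of_irreducible` ⟶ `prime_map_C₂`; `isLocalHom_constantCoeff` ⟶ both).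
DEDUP (D32-14 (2)): `Prime a → Prime (C a)` EXISTS (`Literature.NumberTheory.EllipticCurves.prime_C_of_prime`,
IwasawaAlgebraCharIdealProofs; `IwasawaAlgebra.prime_C`) and `C a ∣ f ↔ ∀ n, a ∣ coeff n f` EXISTS
(`…PowerSeries.C_dvd_iff_forall_dvd_coeff`) — REUSED, not restated; irreducibility of `Φ_{p^(i+1)}(1+T)` = tree
`Rank1Residual.Iwasawa.isEisensteinAt_cyclotomic_comp_X_add_one` via p522499 — REUSED. Mathlib has no `IsLocalHom
PowerSeries.constantCoeff`, no irreducibility descent along `PowerSeries.map`, no prime-element API for `R⟦X⟧⟦Y⟧`.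

WHAT THIS IS NOT: not a discharge of any `_OPEN` binder (the crux stays closed BY NAME modulo
`…thm13_scopedS_OPEN` + the `p = 3` tier, p441716 / p563654); not Kobayashi's main conjecture for any curve at any `p`;
no tier / register word; no route edit, no item; nothing about `H_v`, `𝓛_v(L)`, [HT94]; BSD is not proved by any of this.
PARTITION (D-0054): X6∧r=0 (A6) × 13 (+10~) × p ∈ {3,5} + X6 r1 + D1/D2 literal [G-ledger rows G10, S5 of the
S-scoped tier] — types-the-object-of; closes NONE; 0 cells; 0 kit; 0 new facts.

References: [BurungaleSkinnerTianWan2024] II §2.2.2 = printed §10.2.2 (PREPRINT; ring-theoretic step only); [Matsumura1987]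
Thm. 20.3; cell records bstw-MEMO-17 §2, REPORT-bstw-15 (b), k3c2-MEMO-14 (p522499), bstw-MEMO-6 Part C.
-/

set_option autoImplicit false
-- lint debt (one line): the D-0017 layout `Summits/<S>/<S>/Theorems` forces the duplicated namespace segment.
set_option linter.dupNamespace false

namespace Summit.BirchSwinnertonDyer.BirchSwinnertonDyer.Theorems.TwoVarPrimes

/-! ### §1 Two general facts about `R⟦X⟧` (consumed by §2) -/

section General

variable {R : Type*} [CommRing R]

/-- `PowerSeries.constantCoeff` reflects units (Mathlib `PowerSeries.isUnit_iff_constantCoeff`, as an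
`IsLocalHom`). [folklore] -/
theorem isLocalHom_constantCoeff : IsLocalHom (PowerSeries.constantCoeff (R := R)) :=
  ⟨fun _ h => PowerSeries.isUnit_iff_constantCoeff.mpr h⟩

/-- **Irreducibility descends along a units-reflecting coefficient map**: if `φ : R → S` reflects units and
`map φ f` is irreducible in `S⟦X⟧`, then `f` is irreducible in `R⟦X⟧` (Mathlib `Irreducible.of_map` for the
local hom `PowerSeries.map φ`). [folklore] -/
theorem irreducible_of_irreducible_map {S : Type*} [CommRing S] (φ : R →+* S) [IsLocalHom φ]
    {f : PowerSeries R} (hf : Irreducible (PowerSeries.map φ f)) : Irreducible f :=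
  haveI := PowerSeries.map.isLocalHom φ
  Irreducible.of_map hf

/-- The reduction `T ↦ 0` of the INNER variable undoes the outer-constant embedding:
`map constantCoeff (map C f) = f` for `f ∈ R⟦X⟧ ↪ R⟦T⟧⟦X⟧`. [folklore] -/
theorem map_constantCoeff_map_C (f : PowerSeries R) :
    PowerSeries.map (PowerSeries.constantCoeff (R := R))
      (PowerSeries.map (PowerSeries.C (R := R)) f) = f := by
  ext n
  rw [PowerSeries.coeff_map, PowerSeries.coeff_map, PowerSeries.constantCoeff_C]

/-- **An irreducible `f ∈ R⟦X⟧` stays irreducible in `R⟦T⟧⟦X⟧`** (outer-constant embedding `map C`): reduce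
`T ↦ 0`. [folklore] -/
theorem irreducible_map_C_of_irreducible {f : PowerSeries R} (hf : Irreducible f) :
    Irreducible (PowerSeries.map (PowerSeries.C (R := R)) f) := by
  haveI := isLocalHom_constantCoeff (R := R)
  refine irreducible_of_irreducible_map (PowerSeries.constantCoeff (R := R)) ?_
  rwa [map_constantCoeff_map_C]

end General

/-! ### §2 Prime elements of `Λ_L = Λ₂ = ℤ_p⟦T_+⟧⟦T_−⟧` -/

section TwoVar

open Polynomial Literature.NumberTheory.EllipticCurves

variable (p : ℕ) [hp : Fact p.Prime]

/-- In `Λ₂` (a UFD: regular local of dimension 3 ⇒ factorial, tree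
`IwasawaTheory.uniqueFactorizationMonoid_iwasawaAlgebraTwoVar`) irreducible elements are prime.
[cite: Matsumura1987, Thm. 20.3 (PDF p. 179)] -/
theorem prime_of_irreducible₂ {f : PowerSeries (IwasawaAlgebra p)} (hf : Irreducible f) : Prime f :=
  haveI := Literature.NumberTheory.IwasawaTheory.uniqueFactorizationMonoid_iwasawaAlgebraTwoVar p
  UniqueFactorizationMonoid.irreducible_iff_prime.mp hf

/-- `Λ₂` is a decomposition (pre-GCD) monoid — the explicit instance argument of
`IwasawaTransfer.dvd_of_mul_eq_mul_of_constantCoeff`, discharged. [cite: Matsumura1987, Thm. 20.3 (PDF p. 179)] -/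
theorem decompositionMonoid₂ : DecompositionMonoid (PowerSeries (IwasawaAlgebra p)) :=
  haveI := Literature.NumberTheory.IwasawaTheory.uniqueFactorizationMonoid_iwasawaAlgebraTwoVar p
  inferInstance

/-- `p` is prime in `Λ^cyc = ℤ_p⟦T⟧` (tree `IwasawaAlgebra.prime_C`, `Nat.cast` spelling). [folklore] -/
theorem prime_natCast₁ : Prime (p : IwasawaAlgebra p) := by
  rw [← map_natCast (PowerSeries.C (R := ℤ_[p])) p]
  exact IwasawaAlgebra.prime_C p

/-- **`(p)` is a height-one prime of `Λ_L`**: `p` is a prime element of `Λ₂`. [folklore] -/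
theorem prime_natCast₂ : Prime (p : PowerSeries (IwasawaAlgebra p)) := by
  rw [← map_natCast (PowerSeries.C (R := IwasawaAlgebra p)) p]
  exact prime_C_of_prime (prime_natCast₁ p)

/-- **`(T_+)` is a height-one prime of `Λ_L`**: the inner variable `C X` is prime in `Λ₂` (the outer
variable `T_− = X` is prime by Mathlib `PowerSeries.X_prime`). [folklore] -/
theorem prime_C_X₂ : Prime (PowerSeries.C (PowerSeries.X : IwasawaAlgebra p) : PowerSeries (IwasawaAlgebra p)) :=
  prime_C_of_prime PowerSeries.X_prime

/-- **«height one prime ideals of `Λ^cyc_L`» are height-one primes of `Λ_L`** (BSTW II §10.2.2, the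
dictionary `A = Λ^{ac}`, `X = γ_cyc − 1` of `IwasawaTransfer.dvd_of_mul_eq_mul_of_constantCoeff`): every prime `q` of
the cyclotomic algebra `ℤ_p⟦X⟧` stays prime in `Λ₂` under the outer-constant embedding `map C` (irreducible by
§1's reduction `T ↦ 0`, prime by UFD). [cite: BurungaleSkinnerTianWan2024, Part II §2.2.2 (proof of the theorem labelled KoMC'_lb, last paragraph: "coprime to height one prime ideals of Λ^cyc"; ring-theoretic step only; PREPRINT)] -/
theorem prime_map_C₂ {q : IwasawaAlgebra p} (hq : Prime q) :
    Prime (PowerSeries.map (PowerSeries.C (R := ℤ_[p])) q : PowerSeries (IwasawaAlgebra p)) :=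
  prime_of_irreducible₂ p (irreducible_map_C_of_irreducible hq.irreducible)

/-- `π_i = Φ_{p^(i+1)}(1+T_−) ∈ Λ₂` (p522499's spelling, coefficients in `Λ^cyc`) IS the outer-constant image of
the one-variable `Φ_{p^(i+1)}(1+T) ∈ ℤ_p⟦T⟧`. [folklore] -/
theorem coe_cyclotomic_comp_eq_map_C (i : ℕ) :
    ((((cyclotomic (p ^ (i + 1)) (IwasawaAlgebra p)).comp (X + 1) : (IwasawaAlgebra p)[X])) :
        PowerSeries (IwasawaAlgebra p)) =
      PowerSeries.map (PowerSeries.C (R := ℤ_[p]))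
        ((((cyclotomic (p ^ (i + 1)) ℤ_[p]).comp (X + 1) : ℤ_[p][X])) : IwasawaAlgebra p) := by
  rw [← Polynomial.polynomial_map_coe, map_comp, map_cyclotomic]
  simp

/-- **«`P_i = (π_i)` is a height-one PRIME of the two-variable `Λ_L`»** (bstw-MEMO-17 §2 (S3); REPORT-bstw-15 (b);
closes p522499's NOT-clause): `π_i = Φ_{p^(i+1)}(1+T_−)` is a prime element of `Λ₂ = ℤ_p⟦T_+⟧⟦T_−⟧`, for every
prime `p` and `i ≥ 0` — from the ONE-variable primality `DefectPrime.prime_coe_cyclotomic_comp` (p522499) by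
`prime_map_C₂`. [folklore] -/
theorem prime_coe_cyclotomic_comp₂ (i : ℕ) :
    Prime ((((cyclotomic (p ^ (i + 1)) (IwasawaAlgebra p)).comp (X + 1) : (IwasawaAlgebra p)[X])) :
      PowerSeries (IwasawaAlgebra p)) := by
  rw [coe_cyclotomic_comp_eq_map_C]
  exact prime_map_C₂ p (DefectPrime.prime_coe_cyclotomic_comp p i)

/-- The same prime in the INNER variable: `Φ_{p^(j+1)}(1+T_+) ∈ Λ^cyc ↪ Λ₂` is prime in `Λ₂`. [folklore] -/
theorem prime_C_coe_cyclotomic_comp₂ (j : ℕ) :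
    Prime (PowerSeries.C ((((cyclotomic (p ^ (j + 1)) ℤ_[p]).comp (X + 1) : ℤ_[p][X])) : IwasawaAlgebra p) :
      PowerSeries (IwasawaAlgebra p)) :=
  prime_C_of_prime (DefectPrime.prime_coe_cyclotomic_comp p j)

/-- **`(π_i)` is none of the primes coming from `Λ^cyc`** (not `(p)`, not `(T_+)`, not `(Φ_{p^(j+1)}(1+T_+))`): `π_i` is
associated to NO constant `C q` — p522499's «`(π_i) ∩ Λ^cyc = 0`» (`DefectPrime.eq_zero_of_dvd_C_padicInt₂`).
[folklore] -/
theorem not_associated_coe_cyclotomic_comp₂_C (i : ℕ) (q : IwasawaAlgebra p) :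
    ¬ Associated ((((cyclotomic (p ^ (i + 1)) (IwasawaAlgebra p)).comp (X + 1) : (IwasawaAlgebra p)[X])) :
        PowerSeries (IwasawaAlgebra p)) (PowerSeries.C q) := by
  intro h
  have hq : q = 0 := DefectPrime.eq_zero_of_dvd_C_padicInt₂ p i h.dvd
  rw [hq, map_zero] at h
  exact (prime_coe_cyclotomic_comp₂ p i).ne_zero (associated_zero_iff_eq_zero _ |>.mp h)

/-- **`(π_i) ≠ (T_−)`**: `π_i` is not associated to the outer variable (its reduction `T_− ↦ 0` is `p ≠ 0`,
`DefectPrime.constantCoeff_coe_cyclotomic_comp`). [folklore] -/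
theorem not_associated_coe_cyclotomic_comp₂_X (i : ℕ) :
    ¬ Associated ((((cyclotomic (p ^ (i + 1)) (IwasawaAlgebra p)).comp (X + 1) : (IwasawaAlgebra p)[X])) :
        PowerSeries (IwasawaAlgebra p)) PowerSeries.X := by
  intro h
  have hX := h.symm.dvd
  rw [PowerSeries.X_dvd_iff, DefectPrime.constantCoeff_coe_cyclotomic_comp] at hX
  exact (prime_natCast₁ p).ne_zero hX

end TwoVar

/-! ### §3 The S5 `μ`-descent of BSTW II §10.2.2 on the real `Λ_L`, instance-free -/

section MuDescent

open Literature.NumberTheory.EllipticCurves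

variable (p : ℕ) [hp : Fact p.Prime]

/-- A genuinely cyclotomic element `c = map C c₀` (`c₀ ∈ ℤ_p⟦X⟧`) has the coefficient shape `hcoef` of
`IwasawaTransfer.isRelPrime_of_constantCoeff` with `ϖ = p`: each non-zero coefficient is `p^k ·` unit (Mathlib
`PadicInt.unitCoeff_spec`). [folklore] -/
theorem hcoef_map_C (c₀ : IwasawaAlgebra p) (n : ℕ)
    (hn : PowerSeries.coeff n (PowerSeries.map (PowerSeries.C (R := ℤ_[p])) c₀) ≠ 0) :
    ∃ (k : ℕ) (u : IwasawaAlgebra p), IsUnit u ∧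
      PowerSeries.coeff n (PowerSeries.map (PowerSeries.C (R := ℤ_[p])) c₀) = (p : IwasawaAlgebra p) ^ k * u := by
  rw [PowerSeries.coeff_map] at hn ⊢
  have hx : PowerSeries.coeff n c₀ ≠ 0 := fun h => hn (by rw [h, map_zero])
  refine ⟨(PowerSeries.coeff n c₀).valuation, PowerSeries.C ((PadicInt.unitCoeff hx : ℤ_[p])),
    (Units.isUnit _).map _, ?_⟩
  conv_lhs => rw [PadicInt.unitCoeff_spec hx]
  rw [map_mul, map_pow, map_natCast, mul_comm]

/-- `map C` is injective: a non-zero cyclotomic `c₀` has non-zero image in `Λ₂`. [folklore] -/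
theorem map_C_ne_zero {c₀ : IwasawaAlgebra p} (hc₀ : c₀ ≠ 0) :
    PowerSeries.map (PowerSeries.C (R := ℤ_[p])) c₀ ≠ 0 := fun h0 =>
  hc₀ (by rw [← map_constantCoeff_map_C c₀, h0, map_zero])

/-- **BSTW II §10.2.2 «Hence `𝓛^∘_p(g/L)` is coprime to height one prime ideals of `Λ^cyc_L`», PRINTED FORM on the
real ring**: if `L(0) ≠ 0` and `p ∤ L(0)` (`μ(𝓛^{ac}) = 0`), NO height-one prime of the cyclotomic algebra (no `map C q`,
`q` prime in `ℤ_p⟦X⟧`) divides `L` in `Λ₂` (typed relative-primality form: `IwasawaTransfer.isRelPrime_of_constantCoeff`).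
[cite: BurungaleSkinnerTianWan2024, Part II §2.2.2 (proof of the theorem labelled KoMC'_lb, last paragraph; ring-theoretic step only; PREPRINT)] -/
theorem not_map_C_dvd_of_constantCoeff {q : IwasawaAlgebra p} (hq : Prime q) {L : PowerSeries (IwasawaAlgebra p)}
    (hL0 : PowerSeries.constantCoeff L ≠ 0) (hμ : ¬ (p : IwasawaAlgebra p) ∣ PowerSeries.constantCoeff L) :
    ¬ PowerSeries.map (PowerSeries.C (R := ℤ_[p])) q ∣ L := fun hdvd =>
  (prime_map_C₂ p hq).not_unit
    (IwasawaTransfer.isRelPrime_of_constantCoeff (prime_natCast₁ p) (map_C_ne_zero p hq.ne_zero)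
      (hcoef_map_C p q) hL0 hμ (dvd_refl _) hdvd)

/-- **BSTW II §10.2.2 descent («the divisibility (tpm-div) holds in `Λ_L`»), INSTANCE-FREE on the real ring**
`Λ₂ = A⟦X⟧`, `A = Λ^{ac} = ℤ_p⟦T⟧`, `X = γ_cyc − 1`: if `c · ξ = L · a` with `c = map C c₀ ≠ 0` cyclotomic, `L(0) ≠ 0`
and `p ∤ L(0)`, then `L ∣ ξ` — `IwasawaTransfer.dvd_of_mul_eq_mul_of_constantCoeff` with its `[DecompositionMonoid A⟦X⟧]`
argument and its `hcoef` hypothesis discharged. [cite: BurungaleSkinnerTianWan2024, Part II §2.2.2 (proof of the theorem labelled KoMC'_lb, last paragraph; ring-theoretic step only; PREPRINT)] -/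
theorem dvd_of_mul_eq_mul_of_constantCoeff₂ {c₀ : IwasawaAlgebra p} (hc₀ : c₀ ≠ 0)
    {ξ L a : PowerSeries (IwasawaAlgebra p)}
    (hL0 : PowerSeries.constantCoeff L ≠ 0) (hμ : ¬ (p : IwasawaAlgebra p) ∣ PowerSeries.constantCoeff L)
    (h : PowerSeries.map (PowerSeries.C (R := ℤ_[p])) c₀ * ξ = L * a) : L ∣ ξ :=
  haveI := decompositionMonoid₂ p
  IwasawaTransfer.dvd_of_mul_eq_mul_of_constantCoeff (prime_natCast₁ p) (map_C_ne_zero p hc₀) (hcoef_map_C p c₀)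
    hL0 hμ h

/-- The dual dictionary's upgrade (`A = Λ^cyc` inner, `X = γ_ac − 1`; bstw-MEMO-6 Part C, Theorem S5′) on the real `Λ₂`,
instance-free: from `s · (X^a · ξ) = L · b`, `L` relatively prime to `s`, `L(0) ≠ 0`, conclude `L ∣ ξ`. [cite: BurungaleSkinnerTianWan2024, Part I §4.5.1 with Part II §2.2.2 (ring-theoretic step only; PREPRINT)] -/
theorem dvd_of_mul_eq_mul_of_isRelPrime_of_constantCoeff_ne_zero₂ {s L ξ b : PowerSeries (IwasawaAlgebra p)}
    (hrel : IsRelPrime L s) (hL0 : PowerSeries.constantCoeff L ≠ 0) (a : ℕ)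
    (h : s * (PowerSeries.X ^ a * ξ) = L * b) : L ∣ ξ :=
  haveI := decompositionMonoid₂ p
  IwasawaTransfer.dvd_of_mul_eq_mul_of_isRelPrime_of_constantCoeff_ne_zero hrel hL0 a h

end MuDescent

end Summit.BirchSwinnertonDyer.BirchSwinnertonDyer.Theorems.TwoVarPrimes
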